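import Summits.NavierStokesRegularity.NavierStokesRegularity.Theses.PumpContinuation
import Summits.NavierStokesRegularity.NavierStokesRegularity.Theorems.PerpetualPumpAveragedTypeIBlowup
import Literature.Analysis.FluidPDE.TaoAveragedSobolevProofs
import Literature.Analysis.FluidPDE.TaoAveragedCascadeAssembly
import Literature.Analysis.FluidPDE.TaoAveragedComplexAverageLinear
import Literature.Analysis.FluidPDE.TaoCascadeProjection

/-!
# Route PumpContinuation · crux `EulerProximatePump` (stmt-NavierStokesRegularity-18302) — the quantifier-swapped Door

Support lemmas of the line lead (line `SketchIdeator2`, lead c8, 2026-08-17). Nothing here closes the item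
(`--supports`); no statement of the route is changed. Notation as in
`Theorems/EulerProximatePump/Negative/DoorObstructions.lean`: `tIB[T, M]` is the crux's matrix (Schwartz-data
`H¹⁰_df`-mild Type-I blow-up of the trilinear form `T` at ceiling `M`, no mild extension) and `seg[𝒜, θ]`
the segment form `T_θ = (1-θ)·B̃_𝒜 + θ·B` of the route.

The crux ("the Door") is `∃ 𝒜 sym canc, ∃ M, ∀ δ > 0, ∃ θ ∈ (1-δ,1) ∩ [0,∞), tIB[seg[𝒜, θ], M]`.
This file proves that **with the datum chosen AFTER `δ` the Door is a theorem**, so that the whole content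
of the crux is the uniformity of `𝒜` (and `M`) in `δ`:

* `isMildSolutionFor_congr_memH10df`, `tIB_congr_memH10df` — the mild identity on `[0,S)` only evaluates
  the form on the `H¹⁰_df` diagonal, so two forms agreeing there have the same Schwartz-data blow-ups.
* `exists_form_eq_affine`, `exists_admissible_form_eq_affine` — **Tao's class (1.13) is closed under
  real linear combinations** (the real, probability-normalised version of Tao 2016 §3.2 ¶1, "by
  concatenating finite measure spaces … and using `m_{1,ω}(D)` to absorb scalar factors"; the tree had
  it only for complex finite-measure data, `ComplexAveragingDatum.concat/scale`): for averaging data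
  `𝒜₁, 𝒜₂` and reals `a, b` the fair-coin mixture on `Ω₁ ⊕ Ω₂` of the data with slot-`0` symbols
  rescaled by `2a`, `2b` is an averaging datum whose form is `a·B̃₁ + b·B̃₂` on arguments of finite
  `H¹⁰` norm (absolute convergence of (1.13), `integrable_eulerForm_slot`); symmetry and cancellation
  are inherited.
* `hot_below_one` — **every sub-Euler parameter is a blow-up parameter of some admissible datum**:
  for every `θ ∈ [0,1)` there are a symmetric cancelling `𝒜` and a ceiling `M` with `tIB[seg[𝒜, θ], M]`.
  Take the PROVED seed `𝒜₀` of `PerpetualPump.AveragedTypeIBlowup_of` (stmt-1835: an averaged Type-I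
  blow-up with no mild extension) and `B̃_𝒜 = (1-θ)⁻¹ B̃₀ − θ(1-θ)⁻¹ B` (`𝒜₂ = euler`): then
  `seg[𝒜, θ] = B̃₀` on the `H¹⁰` diagonal.
* `door_of_datum_after_delta` — **the quantifier-swapped Door**:
  `∀ δ > 0, ∃ 𝒜 sym canc, ∃ M, ∃ θ ∈ (1-δ,1) ∩ [0,∞), tIB[seg[𝒜, θ], M]`.
* `seg_one`, `hot_at_one_iff_nsTypeI` — at `θ = 1` every segment form IS the Euler form, so `θ = 1`
  is hot for some admissible datum iff Navier–Stokes itself has a Schwartz-data mild Type-I blow-up.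

Hence the union over admissible data of the bounded-temperature blow-up sets along the segment is all
of `[0,1)` (plus `{1}` iff NSTypeI): "θ close to 1" carries no proximity-to-Euler content unless the
datum is fixed before `δ`, and the crux is exactly its `η`-normal form
(`pumpContinuation_eulerProximatePump_iff_accumulating`: one datum `𝒜`, one ceiling, `B + ηB̃_𝒜`
blowing up for `η → 0⁺`). Any restatement of the Door with a `δ`-dependent datum, and any
strengthening phrased through "distance to the Euler form along the segment", is vacuous.

The file ends with the registered Tools stub `stub_swappedDoorTools` (conjunction of the three results).

## References

* T. Tao, J. Amer. Math. Soc. 29 (2016), arXiv:1402.0290v3, §1.1 (1.13), (1.15); §3.2 ¶1. [Tao2016AveragedNS]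
-/

noncomputable section

-- the nested summit namespace `…NavierStokesRegularity.NavierStokesRegularity…` is the tree's layout (D-0017)
set_option linter.dupNamespace false

open MeasureTheory Set Filter Topology
open scoped ENNReal
open Literature.Analysis.FluidPDE Literature.Analysis.FluidPDE.Tao2016

namespace Summit.NavierStokesRegularity.NavierStokesRegularity.Theorems.PumpContinuationEulerProximatePump

open Literature.Analysis.FunctionSpaces (eFourierSobolevNorm)

/-- Schwartz-data `H¹⁰_df`-mild Type-I blow-up of the form `T` at ceiling `M` with no mild extension —
verbatim the matrix of the crux (a notation, as in `DoorObstructions.lean`). -/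
local notation3 "tIB[" T ", " M "]" =>
  ∃ u₀ : SchwartzMap (EuclideanSpace ℝ (Fin 3)) (EuclideanSpace ℝ (Fin 3)),
    Literature.Analysis.FluidPDE.VectorCalculus.IsDivFree ⇑u₀ ∧ ∃ S : ℝ, 0 < S ∧
    ∃ u : ℝ → Literature.Analysis.FluidPDE.Tao2016.L2C,
      Literature.Analysis.FluidPDE.Tao2016.IsMildSolutionFor T
        (Literature.Analysis.FluidPDE.Tao2016.schwartzL2 u₀) (Set.Ico 0 S) u ∧
      (∀ t ∈ Set.Ico 0 S, MeasureTheory.eLpNorm (u t) ⊤ MeasureTheory.volume ≤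
        ENNReal.ofReal (M / Real.sqrt (S - t))) ∧
      ¬ ∃ S' : ℝ, S < S' ∧ ∃ v : ℝ → Literature.Analysis.FluidPDE.Tao2016.L2C,
        Literature.Analysis.FluidPDE.Tao2016.IsMildSolutionFor T
          (Literature.Analysis.FluidPDE.Tao2016.schwartzL2 u₀) (Set.Ico 0 S') v ∧
        ∀ t ∈ Set.Ico 0 S, v t = u t

/-- The segment form `T_θ = (1-θ)·B̃_𝒜 + θ·B` of route PumpContinuation (verbatim). -/
local notation3 "seg[" 𝒜 ", " θ "]" =>
  fun (a b c : Literature.Analysis.FluidPDE.Tao2016.L2C) =>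
    ((1 - θ : ℝ) : ℂ) * AveragingDatum.form 𝒜 a b c +
      ((θ : ℝ) : ℂ) * Literature.Analysis.FluidPDE.Tao2016.eulerForm a b c

/-! ### The mild identity only sees the `H¹⁰_df` diagonal -/

/-- **Congruence of mild solutions on `[0,S)`**: if two trilinear forms agree on `(a, a, c)` for all
`a, c ∈ H¹⁰_df`, they have the same `H¹⁰_df`-mild solutions on `[0,S)` from any datum (in (1.15) the form
is evaluated at `(u s, u s, e^{(t-s)Δ}w)` with `0 ≤ s ≤ t < S` and `w ∈ H¹⁰_df`). [cite: Tao2016AveragedNS, §1.1 (1.15)] -/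
theorem isMildSolutionFor_congr_memH10df {T T' : L2C → L2C → L2C → ℂ}
    (h : ∀ a c, MemH10df a → MemH10df c → T a a c = T' a a c) (u₀ : L2C) (S : ℝ) (u : ℝ → L2C) :
    IsMildSolutionFor T u₀ (Ico 0 S) u ↔ IsMildSolutionFor T' u₀ (Ico 0 S) u := by
  have key : ∀ {T T' : L2C → L2C → L2C → ℂ}, (∀ a c, MemH10df a → MemH10df c → T a a c = T' a a c) →
      IsMildSolutionFor T u₀ (Ico 0 S) u → IsMildSolutionFor T' u₀ (Ico 0 S) u := by
    intro T T' h hu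
    obtain ⟨hH, hc, hid⟩ := hu
    refine ⟨hH, hc, fun t ht w hw => ?_⟩
    rw [hid t ht w hw]
    congr 1
    refine intervalIntegral.integral_congr fun s hs => ?_
    rw [uIcc_of_le ht.1] at hs
    exact h _ _ (hH s ⟨hs.1, hs.2.trans_lt ht.2⟩) (hw.heat _)
  exact ⟨key h, key fun a c ha hc => (h a c ha hc).symm⟩

/-- **Two forms agreeing on the `H¹⁰_df` diagonal have the same Schwartz-data Type-I blow-ups.** [folklore] -/
theorem tIB_congr_memH10df {T T' : L2C → L2C → L2C → ℂ}
    (h : ∀ a c, MemH10df a → MemH10df c → T a a c = T' a a c) (M : ℝ) : tIB[T, M] ↔ tIB[T', M] := by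
  simp only [isMildSolutionFor_congr_memH10df h]

/-! ### Tao's class is closed under real linear combinations (§3.2 ¶1, real version) -/

/-- **Real linear combinations of averaged Euler forms are averaged Euler forms.** For averaging data
`𝒜₁, 𝒜₂` (Tao 2016, (1.13)) and real `a, b` there is an averaging datum `𝒜` with
`⟨B̃_𝒜(u,v), w⟩ = a ⟨B̃₁(u,v), w⟩ + b ⟨B̃₂(u,v), w⟩` for all `u, v` of finite `H¹⁰` norm and all `w ∈ L²`:
the fair-coin mixture on `Ω₁ ⊕ Ω₂` of the two data with the slot-`0` symbols multiplied by `2a`, `2b`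
(Tao 2016, §3.2 ¶1: concatenate the measure spaces and absorb scalars into `m_{1,ω}(D)`; here the
concatenation is renormalised to a probability measure). The identity needs the absolute convergence
of (1.13) on both pieces (`integrable_eulerForm_slot`, Tao p. 7), whence the finiteness hypotheses. [cite: Tao2016AveragedNS, §3.2 p. 15] -/
theorem exists_form_eq_affine (𝒜₁ 𝒜₂ : AveragingDatum) (a b : ℝ) :
    ∃ 𝒜 : AveragingDatum, ∀ u v w : L2C, eFourierSobolevNorm 10 u < ∞ → eFourierSobolevNorm 10 v < ∞ →
      𝒜.form u v w = (a : ℂ) * 𝒜₁.form u v w + (b : ℂ) * 𝒜₂.form u v w := by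
  classical
  -- the mixture measure on `Ω₁ ⊕ Ω₂`
  let ν : Measure (𝒜₁.Ω ⊕ 𝒜₂.Ω) :=
    (2⁻¹ : ℝ≥0∞) • (Measure.map Sum.inl 𝒜₁.μ + Measure.map Sum.inr 𝒜₂.μ)
  have hν : IsProbabilityMeasure ν := by
    refine ⟨?_⟩
    show ((2⁻¹ : ℝ≥0∞) • (Measure.map Sum.inl 𝒜₁.μ + Measure.map Sum.inr 𝒜₂.μ) :
      Measure (𝒜₁.Ω ⊕ 𝒜₂.Ω)) univ = 1
    rw [Measure.smul_apply, Measure.add_apply, Measure.map_apply measurable_inl MeasurableSet.univ,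
      Measure.map_apply measurable_inr MeasurableSet.univ]
    simp only [Set.preimage_univ, measure_univ, smul_eq_mul]
    rw [one_add_one_eq_two]
    exact ENNReal.inv_mul_cancel two_ne_zero ENNReal.ofNat_ne_top
  -- the rescaled symbols on the two pieces
  let sym : Fin 3 → (𝒜₁.Ω ⊕ 𝒜₂.Ω) → EuclideanSpace ℝ (Fin 3) → ℂ := fun i =>
    Sum.elim (fun θ => ![scaleSymbol (2 * a) (𝒜₁.m 0 θ), 𝒜₁.m 1 θ, 𝒜₁.m 2 θ] i)
      (fun θ => ![scaleSymbol (2 * b) (𝒜₂.m 0 θ), 𝒜₂.m 1 θ, 𝒜₂.m 2 θ] i)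
  have hsym : ∀ i θ, IsRealSymbol (sym i θ) := by
    intro i θ
    cases θ with
    | inl θ =>
      fin_cases i
      · exact (𝒜₁.isRealSymbol 0 θ).scaleSymbol _
      · exact 𝒜₁.isRealSymbol 1 θ
      · exact 𝒜₁.isRealSymbol 2 θ
    | inr θ =>
      fin_cases i
      · exact (𝒜₂.isRealSymbol 0 θ).scaleSymbol _
      · exact 𝒜₂.isRealSymbol 1 θ
      · exact 𝒜₂.isRealSymbol 2 θ
  -- pointwise bound on the moment integrands of the two pieces
  have hmom : ∀ (𝒜' : AveragingDatum) (r : ℝ) (k₁ k₂ k₃ : ℕ),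
      ∫⁻ θ, symbolSeminorm k₁ (scaleSymbol r (𝒜'.m 0 θ)) * symbolSeminorm k₂ (𝒜'.m 1 θ) *
        symbolSeminorm k₃ (𝒜'.m 2 θ) ∂𝒜'.μ < ∞ := by
    intro 𝒜' r k₁ k₂ k₃
    calc ∫⁻ θ, symbolSeminorm k₁ (scaleSymbol r (𝒜'.m 0 θ)) * symbolSeminorm k₂ (𝒜'.m 1 θ) *
          symbolSeminorm k₃ (𝒜'.m 2 θ) ∂𝒜'.μ
        ≤ ∫⁻ θ, ‖(r : ℂ)‖ₑ * (symbolSeminorm k₁ (𝒜'.m 0 θ) * symbolSeminorm k₂ (𝒜'.m 1 θ) *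
          symbolSeminorm k₃ (𝒜'.m 2 θ)) ∂𝒜'.μ := by
          refine lintegral_mono fun θ => ?_
          rw [← mul_assoc, ← mul_assoc]
          gcongr
          exact symbolSeminorm_scaleSymbol_le r (𝒜'.isRealSymbol 0 θ).1 k₁
      _ < ∞ := by
          rw [lintegral_const_mul' _ _ enorm_ne_top]
          exact ENNReal.mul_lt_top enorm_lt_top (𝒜'.moment k₁ k₂ k₃)
  -- the mixture datum
  let 𝒜 : AveragingDatum :=
    { Ω := 𝒜₁.Ω ⊕ 𝒜₂.Ω
      μ := ν
      isProb := hν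
      m := sym
      R := fun i => Sum.elim (𝒜₁.R i) (𝒜₂.R i)
      lam := fun i => Sum.elim (𝒜₁.lam i) (𝒜₂.lam i)
      isRealSymbol := hsym
      det_R := fun i θ => by
        cases θ with
        | inl θ => exact 𝒜₁.det_R i θ
        | inr θ => exact 𝒜₂.det_R i θ
      lam_pos := fun i θ => by
        cases θ with
        | inl θ => exact 𝒜₁.lam_pos i θ
        | inr θ => exact 𝒜₂.lam_pos i θ
      lam_bdd := by
        obtain ⟨C₁, hC₁⟩ := 𝒜₁.lam_bdd
        obtain ⟨C₂, hC₂⟩ := 𝒜₂.lam_bdd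
        refine ⟨max C₁ C₂, fun i θ => ?_⟩
        cases θ with
        | inl θ =>
          have hpos : 0 < C₁ := (𝒜₁.lam_pos i θ).trans_le (hC₁ i θ).2
          exact ⟨(inv_anti₀ hpos (le_max_left _ _)).trans (hC₁ i θ).1,
            (hC₁ i θ).2.trans (le_max_left _ _)⟩
        | inr θ =>
          have hpos : 0 < C₂ := (𝒜₂.lam_pos i θ).trans_le (hC₂ i θ).2
          exact ⟨(inv_anti₀ hpos (le_max_right _ _)).trans (hC₂ i θ).1,
            (hC₂ i θ).2.trans (le_max_right _ _)⟩
      moment := fun k₁ k₂ k₃ => by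
        change ∫⁻ θ, symbolSeminorm k₁ (sym 0 θ) * symbolSeminorm k₂ (sym 1 θ) *
          symbolSeminorm k₃ (sym 2 θ) ∂((2⁻¹ : ℝ≥0∞) •
            (Measure.map Sum.inl 𝒜₁.μ + Measure.map Sum.inr 𝒜₂.μ)) < ∞
        rw [lintegral_smul_measure, lintegral_add_measure, measurableEmbedding_inl.lintegral_map,
          measurableEmbedding_inr.lintegral_map, smul_eq_mul]
        refine ENNReal.mul_lt_top (by simp) (ENNReal.add_lt_top.2 ⟨?_, ?_⟩)
        · exact hmom 𝒜₁ (2 * a) k₁ k₂ k₃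
        · exact hmom 𝒜₂ (2 * b) k₁ k₂ k₃
      measurable_m := fun i ξ hξ => by
        refine measurable_fun_sum ?_ ?_
        · fin_cases i
          · show Measurable fun θ => ((2 * a : ℝ) : ℂ) * 𝒜₁.m 0 θ ξ
            exact (𝒜₁.measurable_m 0 ξ hξ).const_mul _
          · exact 𝒜₁.measurable_m 1 ξ hξ
          · exact 𝒜₁.measurable_m 2 ξ hξ
        · fin_cases i
          · show Measurable fun θ => ((2 * b : ℝ) : ℂ) * 𝒜₂.m 0 θ ξ
            exact (𝒜₂.measurable_m 0 ξ hξ).const_mul _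
          · exact 𝒜₂.measurable_m 1 ξ hξ
          · exact 𝒜₂.measurable_m 2 ξ hξ
      measurable_R := fun i x => measurable_fun_sum (𝒜₁.measurable_R i x) (𝒜₂.measurable_R i x)
      measurable_lam := fun i => measurable_fun_sum (𝒜₁.measurable_lam i) (𝒜₂.measurable_lam i) }
  -- the slots of the mixture
  have hs0l : ∀ (θ : 𝒜₁.Ω) (x : L2C), 𝒜.slot 0 (Sum.inl θ) x = ((2 * a : ℝ) : ℂ) • 𝒜₁.slot 0 θ x := by
    intro θ x
    unfold AveragingDatum.slot AveragingDatum.symbolLp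
    rw [← fourierMultiplier_symbol_smul]
    rfl
  have hs0r : ∀ (θ : 𝒜₂.Ω) (x : L2C), 𝒜.slot 0 (Sum.inr θ) x = ((2 * b : ℝ) : ℂ) • 𝒜₂.slot 0 θ x := by
    intro θ x
    unfold AveragingDatum.slot AveragingDatum.symbolLp
    rw [← fourierMultiplier_symbol_smul]
    rfl
  have hs1l : ∀ (θ : 𝒜₁.Ω) (x : L2C), 𝒜.slot 1 (Sum.inl θ) x = 𝒜₁.slot 1 θ x := fun _ _ => rfl
  have hs2l : ∀ (θ : 𝒜₁.Ω) (x : L2C), 𝒜.slot 2 (Sum.inl θ) x = 𝒜₁.slot 2 θ x := fun _ _ => rfl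
  have hs1r : ∀ (θ : 𝒜₂.Ω) (x : L2C), 𝒜.slot 1 (Sum.inr θ) x = 𝒜₂.slot 1 θ x := fun _ _ => rfl
  have hs2r : ∀ (θ : 𝒜₂.Ω) (x : L2C), 𝒜.slot 2 (Sum.inr θ) x = 𝒜₂.slot 2 θ x := fun _ _ => rfl
  refine ⟨𝒜, fun u v w hu hv => ?_⟩
  -- the integrand and its two restrictions
  set E : (𝒜₁.Ω ⊕ 𝒜₂.Ω) → ℂ := fun θ => eulerForm (𝒜.slot 0 θ u) (𝒜.slot 1 θ v) (𝒜.slot 2 θ w)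
    with hE
  have hEl : (fun θ => E (Sum.inl θ)) =
      fun θ => ((2 * a : ℝ) : ℂ) * eulerForm (𝒜₁.slot 0 θ u) (𝒜₁.slot 1 θ v) (𝒜₁.slot 2 θ w) := by
    funext θ
    simp only [hE, hs0l, hs1l, hs2l, eulerForm_smul₁]
  have hEr : (fun θ => E (Sum.inr θ)) =
      fun θ => ((2 * b : ℝ) : ℂ) * eulerForm (𝒜₂.slot 0 θ u) (𝒜₂.slot 1 θ v) (𝒜₂.slot 2 θ w) := by
    funext θ
    simp only [hE, hs0r, hs1r, hs2r, eulerForm_smul₁]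
  have hIl : Integrable (fun θ => E (Sum.inl θ)) 𝒜₁.μ := by
    rw [hEl]
    exact (𝒜₁.toComplex.integrable_eulerForm_slot w hu hv).const_mul _
  have hIr : Integrable (fun θ => E (Sum.inr θ)) 𝒜₂.μ := by
    rw [hEr]
    exact (𝒜₂.toComplex.integrable_eulerForm_slot w hu hv).const_mul _
  have h1 : Integrable E (Measure.map Sum.inl 𝒜₁.μ) := measurableEmbedding_inl.integrable_map_iff.2 hIl
  have h2 : Integrable E (Measure.map Sum.inr 𝒜₂.μ) := measurableEmbedding_inr.integrable_map_iff.2 hIr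
  change ∫ θ, E θ ∂((2⁻¹ : ℝ≥0∞) • (Measure.map Sum.inl 𝒜₁.μ + Measure.map Sum.inr 𝒜₂.μ)) = _
  rw [integral_smul_measure, integral_add_measure h1 h2, measurableEmbedding_inl.integral_map,
    measurableEmbedding_inr.integral_map]
  change (2⁻¹ : ℝ≥0∞).toReal • ((∫ θ, E (Sum.inl θ) ∂𝒜₁.μ) + ∫ θ, E (Sum.inr θ) ∂𝒜₂.μ) = _
  rw [hEl, hEr, integral_const_mul, integral_const_mul, ENNReal.toReal_inv, ENNReal.toReal_ofNat,
    Complex.real_smul]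
  change ((2⁻¹ : ℝ) : ℂ) * (((2 * a : ℝ) : ℂ) * 𝒜₁.form u v w + ((2 * b : ℝ) : ℂ) * 𝒜₂.form u v w) = _
  push_cast
  ring

/-- **Admissible data are closed under real linear combinations**: if `𝒜₁, 𝒜₂` are symmetric and
cancelling (the hypotheses of Tao's Theorem 1.5 and of both cruxes of the route), so is a datum realising
`a·B̃₁ + b·B̃₂` (symmetry and (1.16) are tested on `H¹⁰_df` only). [cite: Tao2016AveragedNS, §3.2 p. 15] -/
theorem exists_admissible_form_eq_affine {𝒜₁ 𝒜₂ : AveragingDatum} (h₁s : 𝒜₁.IsSymmetric)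
    (h₁c : 𝒜₁.HasCancellation) (h₂s : 𝒜₂.IsSymmetric) (h₂c : 𝒜₂.HasCancellation) (a b : ℝ) :
    ∃ 𝒜 : AveragingDatum, 𝒜.IsSymmetric ∧ 𝒜.HasCancellation ∧
      ∀ u v w : L2C, eFourierSobolevNorm 10 u < ∞ → eFourierSobolevNorm 10 v < ∞ →
        𝒜.form u v w = (a : ℂ) * 𝒜₁.form u v w + (b : ℂ) * 𝒜₂.form u v w := by
  obtain ⟨𝒜, h𝒜⟩ := exists_form_eq_affine 𝒜₁ 𝒜₂ a b
  refine ⟨𝒜, fun u v w hu hv hw => ?_, fun u hu => ?_, h𝒜⟩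
  · rw [h𝒜 u v w hu.1 hv.1, h𝒜 v u w hv.1 hu.1, h₁s u v w hu hv hw, h₂s u v w hu hv hw]
  · rw [h𝒜 u u u hu.1 hu.1, h₁c u hu, h₂c u hu, mul_zero, mul_zero, add_zero]

/-! ### Every sub-Euler parameter is hot for some admissible datum -/

/-- **Every `θ ∈ [0,1)` is a bounded-temperature blow-up parameter of SOME admissible segment.** For
`0 ≤ θ < 1` there are a symmetric cancelling averaging datum `𝒜` and a ceiling `M` such that the segment
form `(1-θ)B̃_𝒜 + θB` has a Schwartz-data `H¹⁰_df`-mild Type-I blow-up at ceiling `M` with no mild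
extension. Proof: the proved seed `PerpetualPump.AveragedTypeIBlowup_of` (stmt-1835) gives `𝒜₀`, `M` with
`tIB[B̃₀, M]`; the admissible datum with `B̃_𝒜 = (1-θ)⁻¹B̃₀ − θ(1-θ)⁻¹B` (`exists_admissible_form_eq_affine`
with `𝒜₂ = euler`) has `seg[𝒜, θ] = B̃₀` on the `H¹⁰_df` diagonal, and the mild identity only sees that
diagonal (`tIB_congr_memH10df`). [folklore] -/
theorem hot_below_one (θ : ℝ) (hθ0 : 0 ≤ θ) (hθ1 : θ < 1) :
    ∃ 𝒜 : AveragingDatum, 𝒜.IsSymmetric ∧ 𝒜.HasCancellation ∧ ∃ M : ℝ, tIB[seg[𝒜, θ], M] := by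
  have _ := hθ0
  obtain ⟨𝒜₀, h0s, h0c, u₀, hdiv, T, hT, u, hmild, ⟨M, hrate⟩, hno⟩ :=
    PerpetualPumpAveragedTypeIBlowup.AveragedTypeIBlowup_of
  have h1θ : (1 - θ : ℝ) ≠ 0 := by
    intro h
    linarith
  obtain ⟨𝒜, hs, hc, hform⟩ := exists_admissible_form_eq_affine h0s h0c
    AveragingDatum.euler_isSymmetric AveragingDatum.euler_hasCancellation
    ((1 - θ)⁻¹) (-(θ * (1 - θ)⁻¹))
  -- on the `H¹⁰_df` diagonal the segment form of `𝒜` at `θ` is the seed's form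
  have hdiag : ∀ p c : L2C, MemH10df p → MemH10df c →
      (seg[𝒜, θ]) p p c = 𝒜₀.form p p c := by
    intro p c hp _
    show ((1 - θ : ℝ) : ℂ) * 𝒜.form p p c + ((θ : ℝ) : ℂ) * eulerForm p p c = 𝒜₀.form p p c
    rw [hform p p c hp.1 hp.1, AveragingDatum.euler_form]
    have h1θ' : ((1 - θ : ℝ) : ℂ) ≠ 0 := by exact_mod_cast h1θ
    push_cast at h1θ' ⊢
    field_simp
    ring
  refine ⟨𝒜, hs, hc, M, ?_⟩
  exact (tIB_congr_memH10df hdiag M).2 ⟨u₀, hdiv, T, hT, u, hmild, hrate, hno⟩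

/-- **The quantifier-swapped Door is a theorem**: for every `δ > 0` there are a symmetric cancelling
datum `𝒜`, a ceiling `M` and a parameter `θ ∈ (1-δ, 1) ∩ [0,∞)` with a Schwartz-data `H¹⁰_df`-mild
Type-I blow-up of `(1-θ)B̃_𝒜 + θB` at ceiling `M` and no mild extension (`hot_below_one` at
`θ = max (1-δ/2) 0`). Compare the crux `EulerProximatePump` = the same with `∃ 𝒜, ∃ M` BEFORE `∀ δ`:
the entire content of the crux is that uniformity. [folklore] -/
theorem door_of_datum_after_delta (δ : ℝ) (hδ : 0 < δ) :
    ∃ 𝒜 : AveragingDatum, 𝒜.IsSymmetric ∧ 𝒜.HasCancellation ∧ ∃ M : ℝ,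
      ∃ θ : ℝ, 1 - δ < θ ∧ θ < 1 ∧ 0 ≤ θ ∧ tIB[seg[𝒜, θ], M] := by
  obtain ⟨𝒜, hs, hc, M, hM⟩ := hot_below_one (max (1 - δ / 2) 0) (le_max_right _ _)
    (max_lt (by linarith) one_pos)
  exact ⟨𝒜, hs, hc, M, max (1 - δ / 2) 0, lt_of_lt_of_le (by linarith) (le_max_left _ _),
    max_lt (by linarith) one_pos, le_max_right _ _, hM⟩

/-! ### The Euler end `θ = 1` -/

/-- **At `θ = 1` every segment form is the Euler form** (`(1-1)·B̃_𝒜 + 1·B = B`, pointwise). [folklore] -/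
theorem seg_one (𝒜 : AveragingDatum) : seg[𝒜, (1 : ℝ)] = eulerForm := by
  funext a b c
  push_cast
  ring

/-- **The Euler end is hot for some admissible datum iff Navier–Stokes has a Schwartz-data mild Type-I
blow-up** (with no mild extension, at some ceiling): `seg[𝒜, 1] = B` for every `𝒜`, and the Euler datum
is admissible. So the union over admissible data of the blow-up sets along the segment is `[0,1)`
(`hot_below_one`) plus `{1}` exactly in the NSTypeI world — the dichotomy the crux cannot see. [folklore] -/
theorem hot_at_one_iff_nsTypeI :
    (∃ 𝒜 : AveragingDatum, 𝒜.IsSymmetric ∧ 𝒜.HasCancellation ∧ ∃ M : ℝ, tIB[seg[𝒜, (1 : ℝ)], M]) ↔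
      ∃ M : ℝ, tIB[eulerForm, M] := by
  constructor
  · rintro ⟨𝒜, -, -, M, hM⟩
    rw [seg_one] at hM
    exact ⟨M, hM⟩
  · rintro ⟨M, hM⟩
    refine ⟨AveragingDatum.euler, AveragingDatum.euler_isSymmetric, AveragingDatum.euler_hasCancellation,
      M, ?_⟩
    rw [seg_one]
    exact hM

/-! ### Registered Tools stub -/

/-- **Registered tools stub `stub_swappedDoorTools`** of line `SketchIdeator2` (crux
stmt-NavierStokesRegularity-18302): the conjunction of `hot_below_one`, `door_of_datum_after_delta` and
`hot_at_one_iff_nsTypeI`, spelled out without notation. [folklore] -/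
theorem stub_swappedDoorTools :
    (∀ θ : ℝ, 0 ≤ θ → θ < 1 → ∃ 𝒜 : Literature.Analysis.FluidPDE.Tao2016.AveragingDatum, 𝒜.IsSymmetric ∧ 𝒜.HasCancellation ∧ ∃ M : ℝ, ∃ u₀ : SchwartzMap (EuclideanSpace ℝ (Fin 3)) (EuclideanSpace ℝ (Fin 3)), Literature.Analysis.FluidPDE.VectorCalculus.IsDivFree ⇑u₀ ∧ ∃ S : ℝ, 0 < S ∧ ∃ u : ℝ → Literature.Analysis.FluidPDE.Tao2016.L2C, Literature.Analysis.FluidPDE.Tao2016.IsMildSolutionFor (fun a b c => ((1 - θ : ℝ) : ℂ) * 𝒜.form a b c + ((θ : ℝ) : ℂ) * Literature.Analysis.FluidPDE.Tao2016.eulerForm a b c) (Literature.Analysis.FluidPDE.Tao2016.schwartzL2 u₀) (Set.Ico 0 S) u ∧ (∀ t ∈ Set.Ico 0 S, MeasureTheory.eLpNorm (u t) ⊤ MeasureTheory.volume ≤ ENNReal.ofReal (M / Real.sqrt (S - t))) ∧ ¬ ∃ S' : ℝ, S < S' ∧ ∃ v : ℝ → Literature.Analysis.FluidPDE.Tao2016.L2C,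 Literature.Analysis.FluidPDE.Tao2016.IsMildSolutionFor (fun a b c => ((1 - θ : ℝ) : ℂ) * 𝒜.form a b c + ((θ : ℝ) : ℂ) * Literature.Analysis.FluidPDE.Tao2016.eulerForm a b c) (Literature.Analysis.FluidPDE.Tao2016.schwartzL2 u₀) (Set.Ico 0 S') v ∧ ∀ t ∈ Set.Ico 0 S, v t = u t) ∧
    (∀ δ : ℝ, 0 < δ → ∃ 𝒜 : Literature.Analysis.FluidPDE.Tao2016.AveragingDatum, 𝒜.IsSymmetric ∧ 𝒜.HasCancellation ∧ ∃ M : ℝ, ∃ θ : ℝ, 1 - δ < θ ∧ θ < 1 ∧ 0 ≤ θ ∧ ∃ u₀ : SchwartzMap (EuclideanSpace ℝ (Fin 3)) (EuclideanSpace ℝ (Fin 3)), Literature.Analysis.FluidPDE.VectorCalculus.IsDivFree ⇑u₀ ∧ ∃ S : ℝ, 0 < S ∧ ∃ u : ℝ → Literature.Analysis.FluidPDE.Tao2016.L2C, Literature.Analysis.FluidPDE.Tao2016.IsMildSolutionFor (fun a b c => ((1 - θ : ℝ) : ℂ) * 𝒜.form a b c + ((θ : ℝ) : ℂ) * Literature.Analysis.FluidPDE.Tao2016.eulerForm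 a b c) (Literature.Analysis.FluidPDE.Tao2016.schwartzL2 u₀) (Set.Ico 0 S) u ∧ (∀ t ∈ Set.Ico 0 S, MeasureTheory.eLpNorm (u t) ⊤ MeasureTheory.volume ≤ ENNReal.ofReal (M / Real.sqrt (S - t))) ∧ ¬ ∃ S' : ℝ, S < S' ∧ ∃ v : ℝ → Literature.Analysis.FluidPDE.Tao2016.L2C, Literature.Analysis.FluidPDE.Tao2016.IsMildSolutionFor (fun a b c => ((1 - θ : ℝ) : ℂ) * 𝒜.form a b c + ((θ : ℝ) : ℂ) * Literature.Analysis.FluidPDE.Tao2016.eulerForm a b c) (Literature.Analysis.FluidPDE.Tao2016.schwartzL2 u₀) (Set.Ico 0 S') v ∧ ∀ t ∈ Set.Ico 0 S, v t = u t) ∧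
    ((∃ 𝒜 : Literature.Analysis.FluidPDE.Tao2016.AveragingDatum, 𝒜.IsSymmetric ∧ 𝒜.HasCancellation ∧ ∃ M : ℝ, ∃ u₀ : SchwartzMap (EuclideanSpace ℝ (Fin 3)) (EuclideanSpace ℝ (Fin 3)), Literature.Analysis.FluidPDE.VectorCalculus.IsDivFree ⇑u₀ ∧ ∃ S : ℝ, 0 < S ∧ ∃ u : ℝ → Literature.Analysis.FluidPDE.Tao2016.L2C, Literature.Analysis.FluidPDE.Tao2016.IsMildSolutionFor (fun a b c => ((1 - (1 : ℝ) : ℝ) : ℂ) * 𝒜.form a b c + (((1 : ℝ) : ℝ) : ℂ) * Literature.Analysis.FluidPDE.Tao2016.eulerForm a b c) (Literature.Analysis.FluidPDE.Tao2016.schwartzL2 u₀) (Set.Ico 0 S) u ∧ (∀ t ∈ Set.Ico 0 S, MeasureTheory.eLpNorm (u t) ⊤ MeasureTheory.volume ≤ ENNReal.ofReal (M / Real.sqrt (S - t))) ∧ ¬ ∃ S' : ℝ, S < S' ∧ ∃ v : ℝ → Literature.Analysis.FluidPDE.Tao2016.L2C, Literature.Analysis.FluidPDE.Tao2016.IsMildSolutionFor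 (fun a b c => ((1 - (1 : ℝ) : ℝ) : ℂ) * 𝒜.form a b c + (((1 : ℝ) : ℝ) : ℂ) * Literature.Analysis.FluidPDE.Tao2016.eulerForm a b c) (Literature.Analysis.FluidPDE.Tao2016.schwartzL2 u₀) (Set.Ico 0 S') v ∧ ∀ t ∈ Set.Ico 0 S, v t = u t) ↔
      ∃ M : ℝ, ∃ u₀ : SchwartzMap (EuclideanSpace ℝ (Fin 3)) (EuclideanSpace ℝ (Fin 3)), Literature.Analysis.FluidPDE.VectorCalculus.IsDivFree ⇑u₀ ∧ ∃ S : ℝ, 0 < S ∧ ∃ u : ℝ → Literature.Analysis.FluidPDE.Tao2016.L2C, Literature.Analysis.FluidPDE.Tao2016.IsMildSolutionFor Literature.Analysis.FluidPDE.Tao2016.eulerForm (Literature.Analysis.FluidPDE.Tao2016.schwartzL2 u₀) (Set.Ico 0 S) u ∧ (∀ t ∈ Set.Ico 0 S, MeasureTheory.eLpNorm (u t) ⊤ MeasureTheory.volume ≤ ENNReal.ofReal (M / Real.sqrt (S - t))) ∧ ¬ ∃ S' : ℝ, S < S' ∧ ∃ v : ℝ → Literature.Analysis.FluidPDE.Tao2016.L2C,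 Literature.Analysis.FluidPDE.Tao2016.IsMildSolutionFor Literature.Analysis.FluidPDE.Tao2016.eulerForm (Literature.Analysis.FluidPDE.Tao2016.schwartzL2 u₀) (Set.Ico 0 S') v ∧ ∀ t ∈ Set.Ico 0 S, v t = u t) :=
  ⟨hot_below_one, door_of_datum_after_delta, hot_at_one_iff_nsTypeI⟩

end Summit.NavierStokesRegularity.NavierStokesRegularity.Theorems.PumpContinuationEulerProximatePump

end
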